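import Literature.NumberTheory.DiophantineApproximation.RidoutRationalsClass
import Literature.NumberTheory.DiophantineApproximation.RidoutRationals
import Summits.ABC.ABC.Theorems.IneffectiveSubspaceDeepRegimeABCStubZeroIntOfRat
import Summits.ABC.ABC.Theorems.IneffectiveSubspaceDeepRegimeABCStubCoreBound

/-!
# `DeepRegimeABC` (stmt-ABC-15121), line `SketchIdeator5R2`: `RidoutCoreBound` holds unconditionally

Glue for the line's Ridout side (card `ridout-core-exhaustion`, crux-ideate r2 k5). The four
landed stubs S1 (`Ridout.false_of_class_abs`), S2 (`Ridout.finite_of_abs_le_one_of_class`), S2′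
(`stub_zeroInt_of_rat`) and S3 (`stub_coreBound`) compose to:

* `ridoutZeroInt_holds` — Ridout's theorem over `ℚ`, archimedean target `0` with partial share,
  INTEGER `p`-adic targets, `padicNorm` vocabulary, UNCONDITIONAL;
* `ridoutCoreBound_holds` — **RidoutCoreBound**: for every `y` and `δ > 0` the abc triples whose
  Ridout core mass `M_y(a,b,c) = Σ_{p ≤ y, p∣abc} v_p(abc) log p + log(c/min(a,b))` is at least
  `(2+δ)·log c` are BOUNDED — Vojta's level-one abc reading of Ridout's theorem
  (`{abc}^S ≥ c^{1−ε}/C(S,ε)` for the places `S = {p ≤ y}`), UNCONDITIONAL and ineffective.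

With `stub_roughReduction` (S4, landed) these reduce the crux `DeepRegimeABC` to the line's open stub
`RoughPowerfulTailABC` (the equivalence is recorded in the companion file
`IneffectiveSubspaceDeepRegimeABCRoughPowerfulTail.lean`). Deliberately NOT here: the rough reduction
and any claim about the open stub.
-/

-- `Summit.ABC.ABC…` is the mandated summit-side namespace (CONVENTIONS §2); the duplicate is deliberate.
set_option linter.dupNamespace false

noncomputable section

open scoped Polynomial

namespace Summit.ABC.ABC.Theorems.DeepRegimeABC

open Literature.NumberTheory.DiophantineGeometry
open Literature.NumberTheory.DiophantineApproximation

/-- **Ridout over `ℚ`, archimedean target `0`, integer `p`-adic targets, `padicNorm` form —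
unconditional.** For a finite set `S ⊆ ℕ` of primes, integers `k_p` and `κ > 2`, only finitely many
rationals `ρ` with `|ρ| ≤ 1` satisfy `|ρ| · ∏_{p∈S} min(1, |ρ − k_p|_p) ≤ den(ρ)^{−κ}`.
(`stub_zeroInt_of_rat` fed with `Ridout.finite_of_abs_le_one_of_class ∘ Ridout.false_of_class_abs`.)
[cite: BombieriGubler2006, Thm. 6.2.3 with 6.2.5–6.2.6 (K = ℚ, α_∞ = 0)] -/
theorem ridoutZeroInt_holds :
    ∀ (S : Finset ℕ), (∀ p ∈ S, p.Prime) → ∀ (k : ℕ → ℤ) (κ : ℝ), 2 < κ →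
      {ρ : ℚ | |(ρ : ℝ)| ≤ 1 ∧
        |(ρ : ℝ)| * (∏ p ∈ S, min (1 : ℝ) ((padicNorm p (ρ - k p) : ℚ) : ℝ)) ≤
          (ρ.den : ℝ) ^ (-κ)}.Finite :=
  stub_zeroInt_of_rat fun S Q hQm hQd θ hθ _κ hκ =>
    Ridout.finite_of_abs_le_one_of_class S Q hQm hQd θ hθ hκ
      (fun c₀ hc₀ _ε hε μ hμ ν hν hsum hsupply =>
        Ridout.false_of_class_abs S Q hQm hQd θ hθ c₀ hc₀ hε μ hμ ν hν hsum hsupply)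

/-- **RidoutCoreBound holds** (unconditionally): for every `y : ℕ` and `δ > 0` there is `B` such
that every abc triple `(a, b, c)` with
`(2+δ)·log c ≤ Σ_{p ∈ primeFactors(abc), p ≤ y} v_p(abc)·log p + log (c / min(a,b))`
has `c ≤ B` — the cored triples of the line `SketchIdeator5R2` are bounded (Ridout's theorem at the
fixed places `{p ≤ y} ∪ {∞}` with the three rational targets `0, 1, ∞`; `stub_coreBound` on top of
`ridoutZeroInt_holds`). [cite: BombieriGubler2006, Thm. 6.2.3 with 6.2.5 (K = ℚ); Vojta1987, §3.2] -/
theorem ridoutCoreBound_holds :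
    ∀ y : ℕ, ∀ δ : ℝ, 0 < δ → ∃ B : ℝ, ∀ a b c : ℕ, IsABCTriple a b c →
      (2 + δ) * Real.log c ≤
        (∑ p ∈ (a * b * c).primeFactors.filter (fun p => p ≤ y),
            ((a * b * c).factorization p : ℝ) * Real.log p)
          + Real.log ((c : ℝ) / ((min a b : ℕ) : ℝ)) →
      (c : ℝ) ≤ B :=
  stub_coreBound ridoutZeroInt_holds

end Summit.ABC.ABC.Theorems.DeepRegimeABC

end
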